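import Literature.AnabelianGeometry.EtaleTheta.ThetaSystems
import Literature.AnabelianGeometry.EtaleTheta.ThetaRigidityLevels
import Literature.AnabelianGeometry.EtaleTheta.Discharge.Sec2EnvelopeLemmas
import Literature.AnabelianGeometry.EtaleTheta.Discharge.Sec2IsoLift
import Mathlib.Topology.Instances.ZMod
import Mathlib.Data.Nat.Factorial.Basic
import Mathlib.Data.ZMod.Basic

/-!
# [EtTh] §2: the Cor 2.18 (iii)/(iv) tower and level facts are SCHEMATA — kernel refutations of their
# universal closures at one explicit degenerate `ThetaEnvTower` (FACT-LIST triage, rule R5)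

Mochizuki, *The Étale Theta Function and its Frobenioid-theoretic Manifestations* [EtTh], Publ. RIMS
45 (2009), §2, Cor 2.18 (iii)–(iv) pp.61–63 (locators = PDF pages of the PRIMS text; bib key
`MochizukiEtTh2009`). PROOF-ONLY companion (no `def`, no new named fact) of `ThetaSystems.lean` /
`ThetaRigidityLevels.lean` (seat abc-iut-L2-t2; nothing there is edited or restated); seat
abc-iut-w5-d071 (gen 5), FACT-LIST rows F-0636/F-0637/F-0638 (`ThetaEnvData.Cor218_iii_PiX`,
`.Cor218_iii_quotient`, `.Cor218_iv_fibre`) and F-0647/F-0648 (`ThetaEnvTower.Cor218_iv_bijective_of_odd`,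
`.Cor218_iv_reduction`). The five named facts are PREDICATES on the interface `ThetaEnvTower E` /
`ThetaEnvData N` (an abstract augmented topological group with cyclotomes and theta cocycles); their
universal closures over the interface are FALSE (`exists_degenerate_tower`), witnessed by ONE tower over
the factorial levels `E = {k!}`: `Π_X = ℤ × ℤ/2` (discrete abelian), `Π_Y = 0 × ℤ/2`, `Π_Ÿ = 1`,
`G_K = 1`, `μ_M = ℤ/M` with trivial character, the single theta cocycle `1`, the genuine reductions
`ℤ/M' ↠ ℤ/M`. There `D_Y = 1` and `[Im s^Θ] = {1}`, so EVERY bi-continuous automorphism of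
`Π_Y[μ_M] = μ_M × Π_Y` is an automorphism of the model environment (`exists_iso_of_DY_eq_bot`): the
shear `(m, p) ↦ (m, p·ι m)` of `Π_Y[μ_2]` reduces to no automorphism of `Π_Y[μ_1]` (F-0648); the
inversion of `μ_6` reduces to the identity of `Π_Y[μ_2]` but is no `μ_6`-conjugation (F-0647, clause 2)
and induces the identity on `Π_Y` without being a `μ`-conjugate of a `Hom(Π_Y/Π_Ÿ, μ_6)`-twist (F-0638);
`Π_X` abelian resp. `Π_Y[μ_1]` discrete kill F-0636/F-0637 (the temp-slimness content).
HONEST FRAMING. A refuted universal closure says NOTHING about the [EtTh] model, where these facts are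
THEOREMS modulo the root's origin clauses (`…cor218_iv_reduction_model`, `…cor219_ii_model`,
`…exists_iso_of_systems_model` in `Discharge/Sec2ModelKummerLifting.lean`;
`ThetaEnvTower.cor218_iv_bijective_of_odd_of_tempSlim` in `Sec2OddBijectivityProofs.lean`;
`…thetaEnvData_cor218_iv_fibre_of_origin` / `…_surjective_modAll` in `Sec2Cor218ivAllLevels.lean`):
the rows are admissible only AT NAMED INSTANCES. No side is taken on [IUTchIII] Cor 3.12.
-/


namespace Literature.AnabelianGeometry.EtaleTheta

open CycEnvelope

universe u

/-! ## Generic lemmas: when is every topological automorphism an automorphism of the model? -/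

/-- In a DISCRETE group the union of the centralisers of the open subgroups is everything (the trivial
subgroup is open) — so the recipe of Prop 2.11 (ii) / Cor 2.18 (iii) needs non-discreteness.
[cite: MochizukiEtTh2009, Prop 2.11(ii) p.44] -/
theorem centralizerUnion_eq_top_of_discreteTopology (P : Type*) [Group P] [TopologicalSpace P]
    [DiscreteTopology P] : centralizerUnion P = ⊤ := by
  refine top_le_iff.mp fun z _ => ⟨⊥, isOpen_discrete _, ?_⟩
  rw [Subgroup.mem_centralizer_iff]
  intro g hg
  rw [Subgroup.coe_bot, Set.mem_singleton_iff] at hg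
  subst hg; simp

namespace ThetaEnvData

variable {N : ℕ+} (T : ThetaEnvData.{u} N)

/-- `Π^tp_Y[μ_N]` is discrete as soon as `Π^tp_X` is (the cyclotome is finite discrete).
[cite: MochizukiEtTh2009, Def 2.13(ii) p.47] -/
theorem discreteTopology_env_of_discrete [DiscreteTopology T.PiX] : DiscreteTopology T.env :=
  DiscreteTopology.of_continuous_injective
    (f := fun x : T.env => (x.left, x.right)) continuous_induced_dom
    (fun _ _ h => SemidirectProduct.ext (Prod.mk.inj h).1 (Prod.mk.inj h).2)

/-- Degenerate interfaces: if `G_K` is trivial, the character acts trivially and `Π^tp_X` is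
commutative, then `D_Y = 1` (every Kummer shift and every `Gal(Y/X)`-conjugation is the identity).
[cite: MochizukiEtTh2009, Def 2.13(i) p.47] -/
theorem DY_eq_bot_of_trivial [Subsingleton T.G] (hchi : ∀ (g : T.G) (a : T.mu), T.chi g a = a)
    (hcomm : ∀ a b : T.PiX, a * b = b * a) : T.DY = ⊥ := by
  rw [ThetaEnvData.DY, Subgroup.closure_eq_bot_iff]
  rintro x (⟨δ, hδ, hc, rfl⟩ | ⟨g, hc, rfl⟩)
  · rw [Set.mem_singleton_iff, ← (TopOut.mk T.env).map_one]
    congr 1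
    refine Subtype.ext (MulEquiv.ext fun x => ?_)
    have h1 : (δ ∘ T.augY) x.right = 1 := by
      rw [Function.comp_apply, Subsingleton.elim (T.augY x.right) (T.augY 1)]; exact hδ.apply_one
    change shift hδ x = x
    ext
    · rw [shift_apply, h1, mul_one]
    · rfl
  · rw [Set.mem_singleton_iff, ← (TopOut.mk T.env).map_one]
    congr 1
    refine Subtype.ext (MulEquiv.ext fun x => ?_)
    change T.conjX g x = x
    ext
    · exact hchi _ _
    · change g * (x.right : T.PiX) * g⁻¹ = x.right
      rw [hcomm g, mul_assoc, mul_inv_cancel, mul_one]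

/-- Degenerate interfaces: if `Π^tp_Ÿ` is trivial, the `μ_N`-conjugacy class of `Im(s^Θ_Ÿ)` is `{1}`.
[cite: MochizukiEtTh2009, Def 2.13(ii) p.47] -/
theorem modelMono_sTheta_eq_of_subsingleton [Subsingleton T.PiYdd] {η : T.PiYdd → T.mu}
    (hη : η ∈ T.thetaCocycles) : (T.modelMono hη).sTheta = {⊥} := by
  have hr : (T.sTheta hη).range = ⊥ :=
    MonoidHom.range_eq_bot_iff.mpr (MonoidHom.ext fun g => by rw [Subsingleton.elim g 1]; simp)
  ext K
  change K ∈ muConjClass T.augY T.chi (T.sTheta hη).range ↔ K ∈ ({⊥} : Set _)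
  rw [hr, Set.mem_singleton_iff]
  exact ⟨fun ⟨a, ha⟩ => ha.trans (Subgroup.map_bot _), fun h => ⟨1, h.trans (Subgroup.map_bot _).symm⟩⟩

/-- Degenerate interfaces: with `D_Y = 1` and `[Im s^Θ] = {1}`, EVERY bi-continuous automorphism of
`Π^tp_Y[μ_N]` is an automorphism of the model mono-theta environment (Def 2.13 (ii)).
[cite: MochizukiEtTh2009, Def 2.13(ii) p.48] -/
theorem exists_iso_of_DY_eq_bot {η : T.PiYdd → T.mu} (hη : η ∈ T.thetaCocycles) (hD : T.DY = ⊥)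
    (hS : (T.modelMono hη).sTheta = {⊥}) (e : T.env ≃ₜ* T.env) :
    ∃ α : (T.modelMono hη).Iso (T.modelMono hη), α.e = e := by
  refine ⟨{ e := e, map_D := ?_, map_sTheta := ?_ }, rfl⟩
  · change T.DY.map _ = T.DY
    rw [hD, Subgroup.map_bot]
  · rw [hS, Set.image_singleton, Subgroup.map_bot]

end ThetaEnvData

/-! ## The degenerate tower and the refutations -/

namespace ThetaEnvTower

set_option maxRecDepth 8192 in
open Multiplicative in
/-- **One degenerate tower refuting five universal closures.** Over the factorial levels `E = {k!}`
there is a `ThetaEnvTower.{0} E` (`Π_X = ℤ × ℤ/2` discrete abelian, `Π_Y = 0 × ℤ/2`, `Π_Ÿ = 1`,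
`G_K = 1`, `μ_M = ℤ/M`, trivial character, theta cocycle `1`, reductions `ℤ/M' ↠ ℤ/M`) for which
`Cor218_iv_reduction` and `Cor218_iv_bijective_of_odd` FAIL, and levels `M = 1`, `M' = 6` at which
`ThetaEnvData.Cor218_iii_PiX`, `.Cor218_iii_quotient` (level `1`) and `.Cor218_iv_fibre` (level `6`)
FAIL. [cite: MochizukiEtTh2009, Cor 2.18(iv) p.61] -/
theorem exists_degenerate_tower :
    ∃ (E : Set ℕ+) (T : ThetaEnvTower.{0} E) (M M' : E),
      ¬ T.Cor218_iv_reduction ∧ ¬ T.Cor218_iv_bijective_of_odd ∧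
      ¬ (T.level M).Cor218_iii_PiX ∧ ¬ (T.level M).Cor218_iii_quotient ∧
      ¬ (T.level M').Cor218_iv_fibre := by
  classical
  /- the levels `E = {k!}` -/
  let fac : ℕ → ℕ+ := fun k => ⟨k.factorial, k.factorial_pos⟩
  let E : Set ℕ+ := Set.range fac
  have hE1 : (1 : ℕ+) ∈ E := ⟨0, rfl⟩
  have hE2 : (2 : ℕ+) ∈ E := ⟨2, PNat.eq rfl⟩
  have hE6 : (6 : ℕ+) ∈ E := ⟨3, PNat.eq rfl⟩
  have hdvd : ∀ {M M' : E}, (M : ℕ+) ∣ (M' : ℕ+) → ((M : ℕ+) : ℕ) ∣ ((M' : ℕ+) : ℕ) := PNat.dvd_iff.1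
  /- the groups `Π_X = ℤ × ℤ/2 ⊇ Π_Y = 0 × ℤ/2 ⊇ Π_Ÿ = 1` -/
  let C : Type := Multiplicative (ℤ × ZMod 2)
  let fstHom : C →* Multiplicative ℤ := (AddMonoidHom.fst ℤ (ZMod 2)).toMultiplicative
  have hfst : ∀ x : C, fstHom x = ofAdd (toAdd x).1 := fun _ => rfl
  have hfst_surj : Function.Surjective fstHom := fun z => ⟨ofAdd (toAdd z, 0), rfl⟩
  let PiY : Subgroup C := fstHom.ker
  have hPiY : ∀ x : C, x ∈ PiY ↔ (toAdd x).1 = 0 := fun x => by rw [MonoidHom.mem_ker, hfst, ofAdd_eq_one]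
  have hidx : ((⊥ : Subgroup C).subgroupOf PiY).index = 2 := by
    rw [Subgroup.bot_subgroupOf, Subgroup.index_bot]
    have e : PiY ≃ ZMod 2 :=
      { toFun := fun x => (toAdd (x : C)).2
        invFun := fun a => ⟨ofAdd (0, a), (hPiY _).2 rfl⟩
        left_inv := fun x => Subtype.ext (toAdd.injective (Prod.ext ((hPiY _).1 x.2).symm rfl))
        right_inv := fun _ => rfl }
    rw [Nat.card_congr e, Nat.card_zmod]
  have hinr : Function.Injective (AddMonoidHom.inr ℤ (ZMod 2)).toMultiplicative := fun a b h =>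
    Multiplicative.toAdd.injective (by simpa using congrArg (fun c : C => (toAdd c).2) h)
  /- the cyclotomes `μ_M = ℤ/M`, reductions and `thetaMod` -/
  let red : ∀ M M' : E, (M : ℕ+) ∣ (M' : ℕ+) →
      (Multiplicative (ZMod ((M' : ℕ+) : ℕ)) →* Multiplicative (ZMod ((M : ℕ+) : ℕ))) :=
    fun M M' h => (ZMod.castHom (hdvd h) (ZMod ((M : ℕ+) : ℕ))).toAddMonoidHom.toMultiplicative
  have hred : ∀ (M M' : E) (h : (M : ℕ+) ∣ (M' : ℕ+)) (a : Multiplicative (ZMod ((M' : ℕ+) : ℕ))),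
      red M M' h a = ofAdd (ZMod.cast (toAdd a) : ZMod ((M : ℕ+) : ℕ)) := fun _ _ _ _ => rfl
  have hcast : ∀ (M : E) (a : ZMod ((M : ℕ+) : ℕ)), ∃ k : ℕ, a = k := fun M a => by
    haveI : NeZero ((M : ℕ+) : ℕ) := ⟨(M : ℕ+).ne_zero⟩
    exact ⟨a.val, (ZMod.natCast_zmod_val a).symm⟩
  let thetaMod : ∀ M : E, (⊤ : Subgroup C) →* Multiplicative (ZMod ((M : ℕ+) : ℕ)) := fun M =>
    ((Int.castAddHom (ZMod ((M : ℕ+) : ℕ))).comp (AddMonoidHom.fst ℤ (ZMod 2))).toMultiplicative.comp (⊤ : Subgroup C).subtype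
  have hthetaMod : ∀ (M : E) (g : (⊤ : Subgroup C)),
      thetaMod M g = ofAdd (((toAdd (g : C)).1 : ℤ) : ZMod ((M : ℕ+) : ℕ)) := fun _ _ => rfl
  /- the tower -/
  let T : ThetaEnvTower.{0} E :=
    { one_mem := hE1
      cofinal := fun n => ⟨fac n, ⟨n, rfl⟩, PNat.dvd_iff.2 (Nat.dvd_factorial n.pos le_rfl)⟩
      total := by
        rintro _ ⟨a, rfl⟩ _ ⟨b, rfl⟩
        rcases le_total a b with h | h
        · exact Or.inl (PNat.dvd_iff.2 (Nat.factorial_dvd_factorial h))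
        · exact Or.inr (PNat.dvd_iff.2 (Nat.factorial_dvd_factorial h))
      PiX := C
      G := PUnit
      aug := 1
      aug_surjective := fun g => ⟨1, Subsingleton.elim _ _⟩
      PiY := PiY
      PiY_normal := inferInstance
      PiY_open := isOpen_discrete _
      galYX := QuotientGroup.quotientKerEquivOfSurjective fstHom hfst_surj
      PiYdd := ⊥
      PiYdd_le := bot_le
      PiYdd_normal := inferInstance
      PiYdd_open := isOpen_discrete _
      index_PiYdd := hidx
      mu := fun M => Multiplicative (ZMod ((M : ℕ+) : ℕ))
      finMu := fun M => @Multiplicative.fintype _ (@ZMod.fintype _ ⟨(M : ℕ+).ne_zero⟩)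
      mu_cyclic := fun M => inferInstance
      card_mu := fun M => by rw [Fintype.card_multiplicative, ZMod.card]
      chi := fun M => 1
      chi_ker_open := fun M => isOpen_discrete _
      thetaCocycles := fun M => {1}
      thetaCocycles_nonempty := fun M => Set.singleton_nonempty _
      isCocycle := fun M η hη => by
        rw [Set.mem_singleton_iff] at hη; subst hη; exact isEnvCocycle_one _ _
      locallyConstant := fun M η hη => by
        rw [Set.mem_singleton_iff] at hη; subst hη; exact IsLocallyConstant.const 1
      mul_coboundary_mem := fun M η hη c => by
        rw [Set.mem_singleton_iff] at hη ⊢; subst hη; funext g; simp [CycEnvelope.coboundary]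
      red := red
      red_surjective := fun M M' h x => by
        haveI : NeZero ((M : ℕ+) : ℕ) := ⟨(M : ℕ+).ne_zero⟩
        refine ⟨ofAdd (((toAdd x).val : ℕ) : ZMod ((M' : ℕ+) : ℕ)), ?_⟩
        rw [hred M M' h, toAdd_ofAdd, ZMod.cast_natCast (hdvd h), ZMod.natCast_zmod_val, ofAdd_toAdd]
      red_self := fun M h a => by rw [hred M M h, ZMod.cast_id, ofAdd_toAdd]
      red_comp := fun M M' M'' h h' a => by
        obtain ⟨k, hk⟩ := hcast M'' (toAdd a)
        rw [hred M M'' (h.trans h'), hred M' M'' h', hred M M' h, toAdd_ofAdd, hk,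
          ZMod.cast_natCast (hdvd (h.trans h')), ZMod.cast_natCast (hdvd h'),
          ZMod.cast_natCast (hdvd h)]
      red_chi := fun M M' h g a => rfl
      red_cocycle_mem := fun M M' h η hη => by
        rw [Set.mem_singleton_iff] at hη ⊢; subst hη; funext x; exact map_one _
      red_cocycle_surj := fun M M' h η hη => by
        rw [Set.mem_singleton_iff] at hη; subst hη
        exact ⟨1, Set.mem_singleton _, funext fun x => map_one _⟩
      lDeltaTheta := ⊤
      thetaMod := thetaMod
      thetaMod_surjective := fun M x => by
        haveI : NeZero ((M : ℕ+) : ℕ) := ⟨(M : ℕ+).ne_zero⟩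
        refine ⟨⟨ofAdd (((toAdd x).val : ℤ), 0), trivial⟩, ?_⟩
        rw [hthetaMod, toAdd_ofAdd, Int.cast_natCast, ZMod.natCast_zmod_val, ofAdd_toAdd]
      red_thetaMod := fun M M' h g => by
        rw [hthetaMod, hthetaMod, hred M M' h, toAdd_ofAdd, ZMod.cast_intCast (hdvd h)] }
  /- bookkeeping on `T` -/
  let M1 : E := ⟨1, hE1⟩
  let M2 : E := ⟨2, hE2⟩
  let M6 : E := ⟨6, hE6⟩
  have h12 : ((M1 : E) : ℕ+) ∣ ((M2 : E) : ℕ+) := one_dvd _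
  have h26 : ((M2 : E) : ℕ+) ∣ ((M6 : E) : ℕ+) := PNat.dvd_iff.2 ⟨3, rfl⟩
  have h2ne : (1 : ZMod 2) ≠ 0 := by decide
  have hact : ∀ (M : E) (q : (T.level M).PiY) (n : (T.level M).mu),
      ((T.level M).chi.comp (T.level M).augY) q n = n := fun _ _ _ => rfl
  haveI hG : ∀ M : E, Subsingleton (T.level M).G := fun _ => inferInstanceAs (Subsingleton PUnit)
  haveI : ∀ M : E, Subsingleton (T.level M).PiYdd := fun _ => inferInstanceAs (Subsingleton (⊥ : Subgroup C))
  haveI hdisc : ∀ M : E, DiscreteTopology (T.level M).PiX := fun _ => inferInstanceAs (DiscreteTopology C)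
  haveI henv : ∀ M : E, DiscreteTopology (T.level M).env := fun M =>
    (T.level M).discreteTopology_env_of_discrete
  have hDY : ∀ M : E, (T.level M).DY = ⊥ := fun M =>
    (T.level M).DY_eq_bot_of_trivial (fun _ _ => rfl) (fun a b => mul_comm a b)
  have hone : ∀ M : E, (1 : (T.level M).PiYdd → (T.level M).mu) ∈ (T.level M).thetaCocycles :=
    fun _ => Set.mem_singleton _
  have hcard : ∀ M : E, Nat.card (T.level M).mu = M := fun M => by rw [Nat.card_eq_fintype_card]; exact T.card_mu M
  -- in this tower EVERY automorphism of the (discrete) group `Π_Y[μ_M]` is an automorphism of `M_M`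
  have hIso : ∀ (M : E) (e : (T.level M).env ≃* (T.level M).env),
      ∃ α : ((T.level M).modelMono (hone M)).Iso ((T.level M).modelMono (hone M)),
        α.e.toMulEquiv = e := fun M e => by
    obtain ⟨α, hα⟩ := (T.level M).exists_iso_of_DY_eq_bot (hone M) (hDY M)
      ((T.level M).modelMono_sTheta_eq_of_subsingleton (hone M))
      { e with continuous_toFun := continuous_of_discreteTopology, continuous_invFun := continuous_of_discreteTopology }
    exact ⟨α, by rw [hα]⟩
  -- the inversion of `μ_6` as an automorphism of `Π_Y[μ_6] = μ_6 × Π_Y`, and its test element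
  let nv : (T.level M6).env ≃* (T.level M6).env :=
    { toFun := fun x => ⟨x.left⁻¹, x.right⟩
      invFun := fun x => ⟨x.left⁻¹, x.right⟩
      left_inv := fun x => SemidirectProduct.ext (inv_inv _) rfl
      right_inv := fun x => SemidirectProduct.ext (inv_inv _) rfl
      map_mul' := fun x y => by
        ext
        · simp only [SemidirectProduct.mul_left, hact, mul_inv]
        · simp only [SemidirectProduct.mul_right] }
  -- a generator `g` of the cyclic group `μ_6` is not its own inverse
  obtain ⟨g, hg⟩ := @IsCyclic.exists_generator (T.level M6).mu _ (T.mu_cyclic M6)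
  have horder : orderOf g = 6 := (orderOf_eq_card_of_forall_mem_zpowers hg).trans (hcard M6)
  have hg6 : g⁻¹ ≠ g := fun h => by
    have hsq : g ^ 2 = 1 := by rw [pow_two]; nth_rewrite 1 [← h]; exact inv_mul_cancel g
    have h62 := orderOf_dvd_of_pow_eq_one hsq
    rw [horder] at h62; exact absurd h62 (by decide)
  have hR : ∀ c : (T.level M6).mu,
      ((MulAut.conj (inMu (T.level M6).augY (T.level M6).chi c)) ⟨g, 1⟩).left = g := fun c => by
    rw [MulAut.conj_apply]; simp only [SemidirectProduct.mul_left, SemidirectProduct.inv_left, hact, SemidirectProduct.left_inl]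
    exact mul_inv_cancel_comm c g
  obtain ⟨αnv, hαnv⟩ := hIso M6 nv
  refine ⟨E, T, M1, M6, ?_, ?_, ?_, ?_, ?_⟩
  · /- F-0648 `Cor218_iv_reduction`: the shear of `Π_Y[μ_2]` reduces to no automorphism of `Π_Y[μ_1]` -/
    intro hred'
    let ι : (T.level M2).mu →* (T.level M2).PiY :=
      ((AddMonoidHom.inr ℤ (ZMod 2)).toMultiplicative).codRestrict PiY (fun _ => (hPiY _).2 rfl)
    let sh : (T.level M2).env ≃* (T.level M2).env :=
      { toFun := fun x => ⟨x.left, x.right * ι x.left⟩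
        invFun := fun x => ⟨x.left, x.right * (ι x.left)⁻¹⟩
        left_inv := fun x => SemidirectProduct.ext rfl (mul_inv_cancel_right _ _)
        right_inv := fun x => SemidirectProduct.ext rfl (inv_mul_cancel_right _ _)
        map_mul' := fun x y => by
          ext
          · simp only [SemidirectProduct.mul_left, hact]
          · simp only [SemidirectProduct.mul_left, SemidirectProduct.mul_right, hact, map_mul]
            exact mul_mul_mul_comm _ _ _ _ }
    have hι : Function.Injective ι := (MonoidHom.injective_codRestrict _ _ _).2 hinr
    obtain ⟨α', hα'⟩ := hIso M2 sh
    obtain ⟨α, hα⟩ := hred' M1 M2 h12 1 (hone M2) α'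
    -- a generator `g2 ≠ 1` of `μ_2`; `μ_1` is trivial
    obtain ⟨g2, hg2⟩ := @IsCyclic.exists_generator (T.level M2).mu _ (T.mu_cyclic M2)
    have hg2ne : g2 ≠ 1 := fun h => by
      have h21 := (orderOf_eq_card_of_forall_mem_zpowers hg2).trans (hcard M2)
      rw [h, orderOf_one] at h21; change (1 : ℕ) = 2 at h21; exact absurd h21 (by decide)
    haveI : Subsingleton (T.mu M1) :=
      Fintype.card_le_one_iff_subsingleton.mp ((T.card_mu M1).trans_le (le_of_eq rfl))
    have h1 : T.redEnv M1 M2 h12 ⟨g2, 1⟩ = 1 := SemidirectProduct.ext (Subsingleton.elim _ _) rfl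
    have key : T.redEnv M1 M2 h12 (sh ⟨g2, 1⟩) = 1 := by
      have := hα ⟨g2, 1⟩; rw [h1, hα'] at this; exact this.trans (map_one _)
    have key' : (1 : (T.level M2).PiY) * ι g2 = 1 := congrArg SemidirectProduct.right key
    rw [one_mul] at key'
    exact hg2ne (hι (key'.trans (map_one ι).symm))
  · /- F-0647 `Cor218_iv_bijective_of_odd`, clause 2, at `(M, M') = (2, 6)` -/
    intro hbij
    have hodd : Odd ((((M6 : E) : ℕ+) / ((M2 : E) : ℕ+) : ℕ)) := by show Odd ((6 : ℕ) / 2); exact ⟨1, rfl⟩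
    have h2 := (hbij M2 M6 h26 hodd 1 (hone M6)).2
    have hRed : T.Reduces h26 αnv.e.toMulEquiv
        (MulAut.conj (inMu (T.level M2).augY (T.level M2).chi (1 : (T.level M2).mu))) := by
      intro x
      rw [map_one, map_one, hαnv, MulAut.one_apply]
      ext
      · change T.red M2 M6 h26 x.left⁻¹ = T.red M2 M6 h26 x.left
        rw [map_inv]
        -- every element of `μ_2` is its own inverse
        refine inv_eq_of_mul_eq_one_right ?_
        have h2 := pow_card_eq_one' (x := T.red M2 M6 h26 x.left)
        rw [hcard M2] at h2; change _ ^ 2 = 1 at h2; rwa [pow_two] at h2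
      · rfl
    obtain ⟨c', hc'⟩ := h2 αnv 1 hRed
    rw [hαnv] at hc'
    exact hg6 ((congrArg (fun e : MulAut (T.level M6).env => (e ⟨g, 1⟩).left) hc').trans (hR c'))
  · /- F-0636 `ThetaEnvData.Cor218_iii_PiX` at level `1`: `Π_X` is abelian and nontrivial -/
    intro hslim
    have h := hslim (ofAdd ((1 : ℤ), (0 : ZMod 2))) (fun q => mul_inv_cancel_comm _ _)
    exact one_ne_zero (congrArg (fun x : C => (toAdd x).1) h)
  · /- F-0637 `ThetaEnvData.Cor218_iii_quotient` at level `1`: `Π_Y[μ_1]` is discrete -/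
    intro hq
    rw [ThetaEnvData.Cor218_iii_quotient, centralizerUnion_eq_top_of_discreteTopology] at hq
    have hmem : algSection (T.level M1).augY (T.level M1).chi ⟨ofAdd ((0 : ℤ), (1 : ZMod 2)), (hPiY _).2 rfl⟩
        ∈ (proj (T.level M1).augY (T.level M1).chi).ker := by rw [← hq]; exact Subgroup.mem_top _
    rw [MonoidHom.mem_ker] at hmem
    exact h2ne (congrArg (fun q : (T.level M1).PiY => (toAdd (q : C)).2) hmem)
  · /- F-0638 `ThetaEnvData.Cor218_iv_fibre`, clause 1, at level `6`: the inversion of `μ_6` -/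
    intro hfib
    obtain ⟨hf, -⟩ := hfib 1 (hone M6)
    obtain ⟨φ, -, c, hc⟩ := hf αnv (fun x => by
      change proj _ _ (αnv.e.toMulEquiv x) = _; rw [hαnv]; rfl)
    have hx := hc ⟨g, 1⟩
    have hproj : proj (T.level M6).augY (T.level M6).chi (⟨g, 1⟩ : (T.level M6).env) = 1 := rfl
    rw [hproj, map_one, map_one, one_mul] at hx
    have hL : (αnv.e ⟨g, 1⟩).left = g⁻¹ := by
      change (αnv.e.toMulEquiv _).left = _; rw [hαnv]; rfl
    exact hg6 (hL.symm.trans ((congrArg SemidirectProduct.left hx).trans (hR c)))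

/-- **F-0648 SCHEMA-REFUTED**: the universal closure of `ThetaEnvTower.Cor218_iv_reduction` (Cor 2.18
(iv), "a natural homomorphism `Aut(M_{M'}) → Aut(M_M)`") over the interface is false.
[cite: MochizukiEtTh2009, Cor 2.18(iv) p.61] -/
theorem not_forall_cor218_iv_reduction :
    ¬ ∀ (E : Set ℕ+) (T : ThetaEnvTower.{0} E), T.Cor218_iv_reduction := fun h => by
  obtain ⟨E, T, _, _, h1, -⟩ := exists_degenerate_tower
  exact h1 (h E T)

/-- **F-0647 SCHEMA-REFUTED**: the universal closure of `ThetaEnvTower.Cor218_iv_bijective_of_odd`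
(Cor 2.18 (iv), "[hence a bijection if `N/M` is odd]") over the interface is false.
[cite: MochizukiEtTh2009, Cor 2.18(iv) p.62] -/
theorem not_forall_cor218_iv_bijective_of_odd :
    ¬ ∀ (E : Set ℕ+) (T : ThetaEnvTower.{0} E), T.Cor218_iv_bijective_of_odd := fun h => by
  obtain ⟨E, T, _, _, -, h2, -⟩ := exists_degenerate_tower
  exact h2 (h E T)

/-- **F-0636 SCHEMA-REFUTED**: the universal closure of `ThetaEnvData.Cor218_iii_PiX` (Cor 2.18 (iii),
injectivity of `Π^tp_X → Aut(Π^tp_Y)` = temp-slimness content) over the interface is false.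
[cite: MochizukiEtTh2009, Cor 2.18(iii) p.61] -/
theorem not_forall_thetaEnvData_cor218_iii_PiX :
    ¬ ∀ (N : ℕ+) (T : ThetaEnvData.{0} N), T.Cor218_iii_PiX := fun h => by
  obtain ⟨E, T, M, _, -, -, h3, -⟩ := exists_degenerate_tower
  exact h3 (h _ (T.level M))

/-- **F-0637 SCHEMA-REFUTED**: the universal closure of `ThetaEnvData.Cor218_iii_quotient` (Cor 2.18
(iii), `Ker(Π• ↠ Π•_Y)` = union of centralisers of open subgroups) over the interface is false.
[cite: MochizukiEtTh2009, Cor 2.18(iii) p.61] -/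
theorem not_forall_thetaEnvData_cor218_iii_quotient :
    ¬ ∀ (N : ℕ+) (T : ThetaEnvData.{0} N), T.Cor218_iii_quotient := fun h => by
  obtain ⟨E, T, M, _, -, -, -, h4, -⟩ := exists_degenerate_tower
  exact h4 (h _ (T.level M))

/-- **F-0638 SCHEMA-REFUTED**: the universal closure of `ThetaEnvData.Cor218_iv_fibre` (Cor 2.18 (iv),
fibres of `Aut(M) → Aut(Π^tp_Y)` = `μ_N`-conjugates of `Hom(Π•_Y/Π•_Ÿ, μ_N)`-twists) over the interface
is false. [cite: MochizukiEtTh2009, Cor 2.18(iv) p.61] -/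
theorem not_forall_thetaEnvData_cor218_iv_fibre :
    ¬ ∀ (N : ℕ+) (T : ThetaEnvData.{0} N), T.Cor218_iv_fibre := fun h => by
  obtain ⟨E, T, _, M', -, -, -, -, h5⟩ := exists_degenerate_tower
  exact h5 (h _ (T.level M'))

end ThetaEnvTower

end Literature.AnabelianGeometry.EtaleTheta
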